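import Summits.QuantumFields.YangMills.Theorems.SwapVirialDeficitBlowUpPeriodicTwoScaleChart
import Summits.QuantumFields.YangMills.Theorems.SwapVirialDeficitBlowUpPrincipalLimit
import HarnessLib

/-!
# The PERIODIC massive-mode rung, brick PM-IIc: the DOMINATOR of the two-scale fibres (set inclusion, finite volume, eventual form)
# (free-hands support of ⟨stmt-QuantumFields-24196⟩ `SwapVirialDeficit.ToronSoftnessSharp`; hypotheses (hB)(hBfin)(hsub) of ✓`BlowUp.tendsto_measure_sublevel_twoScale`
# for LEAD ym-line-sfw-p2 g96's ✓`twoScaleFibre` (PM-I), memo `sfw-p2-g96-memo-24196-PM-design.md` §3 brick PM-IIc)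

For `u, s > 0` and `a₀² + u² ≤ 4` the two-scale fibre `twoScaleFibre L u s a₀ ⊆ (ℍ×ℍ)×ℍ × (Fol L → ℍ)` lies in the FIXED product set
`B_L ×ˢ B_F`, `B_L = (S_{1,1/R})⁻¹(domSet4) ∪ {a letter vanishes}` (`R = 20L²`; K4's uniform dominating event ✓`domSet4`, dilated), `B_F = box(12L²)^{Fol} ∪ {a follower
vanishes}` (★★★ `twoScaleFibre_subset_dominator`).  Route: ✓`section_periodicBlowUpSet_subset` (PD-I) ⟹ ✓`dil3P_inv_mem_rescaledSet4` ⟹ K4's ✓`scaleQ3_mem_rescaledSet4_iff`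
through the factorisation `S_{u, 1/(Ru)} = S_{u/c, c/2u} ∘ S_{c, 2/(Rc)}` (`c = √(a₀²+u²)`) ⟹ ✓`twoScaleSet4_subset_domSet4` ⟹ `tvSq`/`pairSq` scaling.  Then ★ `measurableSet_twoScaleDominator`,
★ `volume_twoScaleDominator_lt_top`, ★ `eventually_twoScaleFibre_subset` (along `(𝓝[>]0 ×ˢ 𝓝[>]0) ×ˢ 𝓝 a₀`, `|a₀| ≤ 1`).
HONEST LABEL: plumbing for a plan-level fixed-`L` rung of a DRAFT line; PM-IIb/IIb′ (LEAD g96) NOT proved here; ⟨24196⟩/⟨24497⟩ OPEN; own crux ⟨22884⟩ OPEN (blocked-on ⟨19935⟩);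
the Yang–Mills mass gap is NOT proved; no summit is proved by a line.  Width seat ym-line-sfw-p2-w3 g64 (cell ym-idea-1, free hands), `--supports stmt-QuantumFields-24196`.
THEOREMS ONLY (0 `def`, 0 `sorry`), standard axioms.  References: [cite: Luscher1983, §2]; [cite: GonzalezarroyoAltes1988]; [folklore].
-/

set_option autoImplicit false

noncomputable section

open MeasureTheory Quaternion Set Filter Topology
open scoped Quaternion ENNReal
open Literature.MathematicalPhysics.QuantumLattice
open Literature.MathematicalPhysics.QuantumFieldTheory hiding SU2
open Summit.QuantumFields.YangMills.Theorems.SwapTwistDeficit.ToronLog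

attribute [local instance] Literature.Analysis.FluidPDE.Tao2016.quatMeasurableSpace
  Literature.Analysis.FluidPDE.Tao2016.quatBorelSpace
  Literature.MathematicalPhysics.QuantumLattice.secondCountableTopology_su2

namespace Summit.QuantumFields.YangMills.Theorems.SwapVirialDeficit.BlowUpRing

open Summit.QuantumFields.YangMills.Theorems.FemtoTransferGap
open Summit.QuantumFields.YangMills.Theorems.FemtoTransferGap.TT
open Summit.QuantumFields.YangMills.Theorems.SwapVirialDeficit.ZeroModeSigma (ball3 dilateIm dilateIm_apply)
open Summit.QuantumFields.YangMills.Theorems.SwapVirialDeficit.ZeroModeGroup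
open Summit.QuantumFields.YangMills.Theorems.SwapVirialDeficit.BlowUp (axialLetters dil3P dil3P_apply follower_box pi_volume_followerBox_ne_top)

variable {L : ℕ} [NeZero L]

/-! ## §1 Diagonal scalings compose -/

omit [NeZero L] in
/-- `S_{mm′, ll′} = S_{m,l} ∘ S_{m′,l′}`. [folklore] -/
theorem scaleQ_comp (m l m' l' : ℝ) (x : ℍ) : scaleQ (m * m') (l * l') x = scaleQ m l (scaleQ m' l' x) := by
  ext <;> simp only [scaleQ_re, scaleQ_imI, scaleQ_imJ, scaleQ_imK] <;> ring

omit [NeZero L] in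
/-- `S³_{mm′, ll′} = S³_{m,l} ∘ S³_{m′,l′}`. [folklore] -/
theorem scaleQ3_comp (m l m' l' : ℝ) (w : (ℍ × ℍ) × ℍ) : scaleQ3 (m * m') (l * l') w = scaleQ3 m l (scaleQ3 m' l' w) := by
  simp only [scaleQ3_apply, scaleQ_comp]

omit [NeZero L] in
/-- `D_t = S_{1,t}`. [folklore] -/
theorem dilate_eq_scaleQ (t : ℝ) (x : ℍ) : dilate t x = scaleQ 1 t x := by
  rw [dilate_apply, scaleQ_apply, one_mul]

omit [NeZero L] in
/-- `dil3P t = S³_{1,t}`. [folklore] -/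
theorem dil3P_eq_scaleQ3 (t : ℝ) (w : (ℍ × ℍ) × ℍ) : dil3P t w = scaleQ3 1 t w := by
  rw [dil3P_apply, scaleQ3_apply, dilate_eq_scaleQ, dilate_eq_scaleQ, dilate_eq_scaleQ]

omit [NeZero L] in
/-- `S_{m,l}` has trivial kernel for `m, l ≠ 0`. [folklore] -/
theorem scaleQ_ne_zero {m l : ℝ} (hm : m ≠ 0) (hl : l ≠ 0) {x : ℍ} (hx : x ≠ 0) : scaleQ m l x ≠ 0 := by
  intro h
  apply hx
  have hre : x.re = 0 := by simpa [scaleQ_re] using congrArg (fun q : ℍ => q.re) h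
  have hI : x.imI = 0 := by simpa [scaleQ_imI, hm] using congrArg (fun q : ℍ => q.imI) h
  have hJ : x.imJ = 0 := by simpa [scaleQ_imJ, hl] using congrArg (fun q : ℍ => q.imJ) h
  have hK : x.imK = 0 := by simpa [scaleQ_imK, hl] using congrArg (fun q : ℍ => q.imK) h
  ext <;> simp [hre, hI, hJ, hK]

/-! ## §2 How `domSet4` scales -/

omit [NeZero L] in
/-- `tvSq (S_{m,l} x) = l²·tvSq x`. [folklore] -/
theorem tvSq_scaleQ (m l : ℝ) (x : ℍ) : tvSq (scaleQ m l x) = l ^ 2 * tvSq x := by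
  simp only [tvSq, scaleQ_imJ, scaleQ_imK]; ring

omit [NeZero L] in
/-- `pairSq (S x) (S y) = (ml)²·pairSq x y`. [folklore] -/
theorem pairSq_scaleQ (m l : ℝ) (x y : ℍ) : pairSq (scaleQ m l x) (scaleQ m l y) = (m * l) ^ 2 * pairSq x y := by
  simp only [pairSq, scaleQ_imI, scaleQ_imJ, scaleQ_imK]; ring

omit [NeZero L] in
/-- Monotonicity of the scaled dominating event: `S³_{c,d} w ∈ U`, `1/R ≤ d`, `1/R ≤ cd` (`R > 0`) ⟹ `S³_{1,1/R} w ∈ U`. [folklore] -/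
theorem scaleQ3_mem_domSet4_mono {c d R : ℝ} (hR : 0 < R) (hd : R⁻¹ ≤ d) (hcd : R⁻¹ ≤ c * d)
    {w : (ℍ × ℍ) × ℍ} (h : scaleQ3 c d w ∈ domSet4) : scaleQ3 1 R⁻¹ w ∈ domSet4 := by
  simp only [domSet4, Set.mem_setOf_eq, scaleQ3_apply, scaleQ_re, tvSq_scaleQ, pairSq_scaleQ, one_mul] at h ⊢
  obtain ⟨h1, h2, h3, h4, h5, h6, h7, h8, h9⟩ := h
  have hd2 : R⁻¹ ^ 2 ≤ d ^ 2 := pow_le_pow_left₀ (inv_nonneg.2 hR.le) hd 2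
  have hcd2 : R⁻¹ ^ 2 ≤ (c * d) ^ 2 := pow_le_pow_left₀ (inv_nonneg.2 hR.le) hcd 2
  refine ⟨h1, h2, h3, ?_, ?_, ?_, ?_, ?_, ?_⟩
  · exact (mul_le_mul_of_nonneg_right hd2 (tvSq_nonneg _)).trans h4
  · exact (mul_le_mul_of_nonneg_right hd2 (tvSq_nonneg _)).trans h5
  · exact (mul_le_mul_of_nonneg_right hd2 (tvSq_nonneg _)).trans h6
  · exact (mul_le_mul_of_nonneg_right hcd2 (pairSq_nonneg _ _)).trans h7
  · exact (mul_le_mul_of_nonneg_right hcd2 (pairSq_nonneg _ _)).trans h8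
  · exact (mul_le_mul_of_nonneg_right hcd2 (pairSq_nonneg _ _)).trans h9

/-! ## §3 The inclusion -/

/-- ★★★ **THE TWO-SCALE FIBRES LIE IN A FIXED FINITE-VOLUME SET.**  For `0 < u`, `0 < s`, `a₀² + u² ≤ 4`:
`twoScaleFibre L u s a₀ ⊆ ((S³_{1,1/(20L²)})⁻¹ domSet4 ∪ {a letter = 0}) ×ˢ (box(12L²)^{Fol} ∪ {a follower = 0})`. [cite: Luscher1983, §2] -/
theorem twoScaleFibre_subset_dominator {u s a₀ : ℝ} (hu : 0 < u) (hs : 0 < s) (hc : a₀ ^ 2 + u ^ 2 ≤ 4) :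
    twoScaleFibre L u s a₀ ⊆
      ((scaleQ3 1 (20 * (L : ℝ) ^ 2)⁻¹ ⁻¹' domSet4) ∪ {w | w.1.1 = 0 ∨ w.1.2 = 0 ∨ w.2 = 0}) ×ˢ
        ((Set.univ.pi fun _ : Fol L => {y : ℍ | |y.re| < 1 ∧ ‖y.im‖ ≤ 12 * (L : ℝ) ^ 2 * Real.sqrt 1}) ∪ {y | ∃ i, y i = 0}) := by
  rintro ⟨q, y⟩ hq
  have hL : (0 : ℝ) < L := by exact_mod_cast NeZero.pos L
  set R : ℝ := 20 * (L : ℝ) ^ 2 with hRdef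
  have hR : 0 < R := by positivity
  set t : ℝ := u ^ 2 * s with htdef
  have ht : 0 < t := by positivity
  set a : ℍ := hubAt a₀ (u ^ 2) with hadef
  set w : (ℍ × ℍ) × ℍ := scaleQ3 u u⁻¹ q with hwdef
  -- membership, threshold `1·t²`
  have hmem : y ∈ Prod.mk w ⁻¹' (Prod.mk a ⁻¹' periodicBlowUpSet L (fun _ => false) (fun _ => 1) t (1 * t ^ 2)) := by
    rw [one_mul]; exact hq
  obtain ⟨hfol, hball, hN⟩ := section_periodicBlowUpSet_subset zero_le_one ht a w y hmem
  rw [Real.sqrt_one, mul_one] at hN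
  refine Set.mk_mem_prod ?_ ?_
  · -- leaders
    by_cases hz : q.1.1 = 0 ∨ q.1.2 = 0 ∨ q.2 = 0
    · exact Or.inr hz
    · left
      simp only [not_or] at hz
      obtain ⟨hx, hy', hzz⟩ := hz
      have hu0 : u ≠ 0 := hu.ne'
      have hui : u⁻¹ ≠ 0 := inv_ne_zero hu0
      have hx1 : w.1.1 ≠ 0 := by rw [hwdef, scaleQ3_apply]; exact scaleQ_ne_zero hu0 hui hx
      have hy1 : w.1.2 ≠ 0 := by rw [hwdef, scaleQ3_apply]; exact scaleQ_ne_zero hu0 hui hy'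
      have hz1 : w.2 ≠ 0 := by rw [hwdef, scaleQ3_apply]; exact scaleQ_ne_zero hu0 hui hzz
      -- the hub
      obtain ⟨-, hI, -, -, hn2⟩ := hubAt_components (a₀ := a₀) (sq_nonneg u)
      rw [Real.sqrt_sq hu.le] at hI
      have haxis : axisPoint a = a := axisPoint_hubAt a₀ (u ^ 2)
      have ha : a ≠ 0 := by
        intro h0
        have : (hubAt a₀ (u ^ 2)).imI = 0 := by rw [← hadef, h0]; rfl
        rw [hI] at this; exact hu0 this
      have hres := dil3P_inv_mem_rescaledSet4 ht hR haxis ha hx1 hy1 hz1 hball hN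
      -- K4's normaliser at the hub: m = u/c, l = c/(2u), c = ‖a‖ = √(a₀²+u²)
      set c : ℝ := Real.sqrt (a₀ ^ 2 + u ^ 2) with hcdef
      have hc0 : 0 < c := Real.sqrt_pos.2 (by positivity)
      have hcn : ‖a‖ = c := by
        rw [hcdef, ← hn2, Real.sqrt_sq (norm_nonneg _)]
      have hc2 : c ≤ 2 := by
        rw [hcdef, show (2 : ℝ) = Real.sqrt 4 by rw [show (4 : ℝ) = 2 ^ 2 by norm_num, Real.sqrt_sq (by norm_num)]]
        exact Real.sqrt_le_sqrt hc
      have hml : 4 * ((u / c) ^ 2 * (c / (2 * u)) ^ 2) = 1 := by field_simp; ring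
      have hl : 4 * (a.imI ^ 2 * (c / (2 * u)) ^ 2) = ‖a‖ ^ 2 := by
        rw [show a.imI = u from hI, hcn]; field_simp; ring
      have ha' : ‖a‖ ≠ 0 := by rw [hcn]; exact hc0.ne'
      -- `dil3P R⁻¹ w = S³_{u/c, c/2u} (S³_{c, 2/(Rc)} q)`
      have hc0' : c ≠ 0 := hc0.ne'
      have hR0 : R ≠ 0 := hR.ne'
      have e1 : (1 : ℝ) * u = u / c * c := by rw [div_mul_cancel₀ _ hc0', one_mul]
      have e2 : R⁻¹ * u⁻¹ = c / (2 * u) * (2 / (R * c)) := by field_simp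
      have hfac : dil3P R⁻¹ w = scaleQ3 (u / c) (c / (2 * u)) (scaleQ3 c (2 / (R * c)) q) := by
        rw [← scaleQ3_comp, dil3P_eq_scaleQ3, hwdef, ← scaleQ3_comp, e1, e2]
      rw [hfac, scaleQ3_mem_rescaledSet4_iff hml hl ha'] at hres
      have hdom := twoScaleSet4_subset_domSet4 (sq_nonneg _) (by positivity) (by positivity) hres
      have hd : R⁻¹ ≤ 2 / (R * c) := by
        rw [le_div_iff₀ (by positivity)]
        calc R⁻¹ * (R * c) = c := by field_simp
          _ ≤ 2 := hc2
      have hcd : R⁻¹ ≤ c * (2 / (R * c)) := by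
        rw [show c * (2 / (R * c)) = 2 * R⁻¹ by field_simp]
        have : 0 ≤ R⁻¹ := inv_nonneg.2 hR.le
        linarith
      exact scaleQ3_mem_domSet4_mono hR hd hcd hdom
  · -- followers
    by_cases hz : ∃ i, y i = 0
    · exact Or.inr hz
    · left
      simp only [not_exists] at hz
      refine Set.mem_univ_pi.2 fun i => ?_
      exact follower_box ht (by positivity) (hfol i).1 (dilateIm_ne_zero ht.ne' (hz i)) (hfol i).2

/-! ## §4 Measurability, finite volume, eventual form -/

/-- The dominator is measurable. [folklore] -/
theorem measurableSet_twoScaleDominator :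
    MeasurableSet ((((scaleQ3 1 (20 * (L : ℝ) ^ 2)⁻¹ ⁻¹' domSet4) ∪ {w : (ℍ × ℍ) × ℍ | w.1.1 = 0 ∨ w.1.2 = 0 ∨ w.2 = 0}) ×ˢ
        ((Set.univ.pi fun _ : Fol L => {y : ℍ | |y.re| < 1 ∧ ‖y.im‖ ≤ 12 * (L : ℝ) ^ 2 * Real.sqrt 1}) ∪ {y : Fol L → ℍ | ∃ i, y i = 0}))) := by
  refine MeasurableSet.prod (MeasurableSet.union (measurableSet_domSet4.preimage (measurable_scaleQ3 _ _)) ?_) (MeasurableSet.union ?_ ?_)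
  · have h1 : MeasurableSet {w : (ℍ × ℍ) × ℍ | w.1.1 = 0} := (measurableSet_singleton (0 : ℍ)).preimage (measurable_fst.comp measurable_fst)
    have h2 : MeasurableSet {w : (ℍ × ℍ) × ℍ | w.1.2 = 0} := (measurableSet_singleton (0 : ℍ)).preimage (measurable_snd.comp measurable_fst)
    have h3 : MeasurableSet {w : (ℍ × ℍ) × ℍ | w.2 = 0} := (measurableSet_singleton (0 : ℍ)).preimage measurable_snd
    simp only [Set.setOf_or]
    exact h1.union (h2.union h3)
  · refine MeasurableSet.univ_pi fun _ => ?_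
    exact (measurableSet_lt (Quaternion.continuous_re.measurable.abs) measurable_const).inter
      (measurableSet_le (Quaternion.continuous_im.measurable.norm) measurable_const)
  · simp only [Set.setOf_exists]
    exact MeasurableSet.iUnion fun i => (measurableSet_singleton (0 : ℍ)).preimage (measurable_pi_apply i)

/-- ★ The dominator has finite `vol³ ⊗ vol^{Fol}`-measure. [folklore] -/
theorem volume_twoScaleDominator_lt_top :
    ((volume : Measure ((ℍ × ℍ) × ℍ)).prod (Measure.pi fun _ : Fol L => (volume : Measure ℍ)))
      ((((scaleQ3 1 (20 * (L : ℝ) ^ 2)⁻¹ ⁻¹' domSet4) ∪ {w : (ℍ × ℍ) × ℍ | w.1.1 = 0 ∨ w.1.2 = 0 ∨ w.2 = 0}) ×ˢ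
        ((Set.univ.pi fun _ : Fol L => {y : ℍ | |y.re| < 1 ∧ ‖y.im‖ ≤ 12 * (L : ℝ) ^ 2 * Real.sqrt 1}) ∪ {y : Fol L → ℍ | ∃ i, y i = 0}))) < ∞ := by
  have hL : (0 : ℝ) < L := by exact_mod_cast NeZero.pos L
  set R : ℝ := 20 * (L : ℝ) ^ 2 with hRdef
  have hR : 0 < R := by positivity
  -- leader part
  have hZL : (volume : Measure ((ℍ × ℍ) × ℍ)) {w : (ℍ × ℍ) × ℍ | w.1.1 = 0 ∨ w.1.2 = 0 ∨ w.2 = 0} = 0 := by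
    have h := ae_iff.1 ae_volume3_letters_ne_zero
    have hset : {w : (ℍ × ℍ) × ℍ | w.1.1 = 0 ∨ w.1.2 = 0 ∨ w.2 = 0} = {w : (ℍ × ℍ) × ℍ | ¬(w.1.1 ≠ 0 ∧ w.1.2 ≠ 0 ∧ w.2 ≠ 0)} := by
      ext w; simp only [Set.mem_setOf_eq, not_and_or, not_not]
    rw [hset]; exact h
  have hpre : (volume : Measure ((ℍ × ℍ) × ℍ)) (scaleQ3 1 R⁻¹ ⁻¹' domSet4) < ∞ := by
    have hdet : (1 : ℝ) * R⁻¹ ^ 2 ≠ 0 := by positivity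
    have hvol : (volume : Measure ((ℍ × ℍ) × ℍ)) = ((volume : Measure ℍ).prod (volume : Measure ℍ)).prod (volume : Measure ℍ) := rfl
    rw [hvol, ← Measure.map_apply (measurable_scaleQ3 1 R⁻¹) measurableSet_domSet4, map_scaleQ3_volume hdet, Measure.smul_apply, smul_eq_mul]
    exact ENNReal.mul_lt_top (ENNReal.mul_lt_top (ENNReal.mul_lt_top ENNReal.ofReal_lt_top ENNReal.ofReal_lt_top) ENNReal.ofReal_lt_top)
      volume_domSet4_lt_top
  have hA : (volume : Measure ((ℍ × ℍ) × ℍ)) ((scaleQ3 1 R⁻¹ ⁻¹' domSet4) ∪ {w : (ℍ × ℍ) × ℍ | w.1.1 = 0 ∨ w.1.2 = 0 ∨ w.2 = 0}) < ∞ := by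
    refine (measure_union_le _ _).trans_lt ?_
    rw [hZL, add_zero]; exact hpre
  -- follower part
  have hZF : (Measure.pi fun _ : Fol L => (volume : Measure ℍ)) {y : Fol L → ℍ | ∃ i, y i = 0} = 0 := by
    simp only [Set.setOf_exists]
    refine measure_iUnion_null fun i => ?_
    show Measure.pi (fun _ : Fol L => (volume : Measure ℍ)) (Function.eval i ⁻¹' {0}) = 0
    exact Measure.pi_eval_preimage_null (fun _ : Fol L => (volume : Measure ℍ)) (measure_singleton (0 : ℍ))
  have hC : (Measure.pi fun _ : Fol L => (volume : Measure ℍ))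
      ((Set.univ.pi fun _ : Fol L => {y : ℍ | |y.re| < 1 ∧ ‖y.im‖ ≤ 12 * (L : ℝ) ^ 2 * Real.sqrt 1}) ∪ {y : Fol L → ℍ | ∃ i, y i = 0}) < ∞ := by
    refine (measure_union_le _ _).trans_lt ?_
    rw [hZF, add_zero]; exact lt_top_iff_ne_top.2 (pi_volume_followerBox_ne_top _)
  rw [Measure.prod_prod]; exact ENNReal.mul_lt_top hA hC

/-- ★ **EVENTUAL FORM** along the two-scale filter at any `a₀` with `|a₀| ≤ 1`: the fibres eventually lie in the dominator. [folklore] -/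
theorem eventually_twoScaleFibre_subset {a₀ : ℝ} (ha₀ : |a₀| ≤ 1) :
    ∀ᶠ q : (ℝ × ℝ) × ℝ in (𝓝[>] (0 : ℝ) ×ˢ 𝓝[>] (0 : ℝ)) ×ˢ 𝓝 a₀,
      twoScaleFibre L q.1.1 q.1.2 q.2 ⊆
        ((scaleQ3 1 (20 * (L : ℝ) ^ 2)⁻¹ ⁻¹' domSet4) ∪ {w : (ℍ × ℍ) × ℍ | w.1.1 = 0 ∨ w.1.2 = 0 ∨ w.2 = 0}) ×ˢ
          ((Set.univ.pi fun _ : Fol L => {y : ℍ | |y.re| < 1 ∧ ‖y.im‖ ≤ 12 * (L : ℝ) ^ 2 * Real.sqrt 1}) ∪ {y : Fol L → ℍ | ∃ i, y i = 0}) := by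
  have hu : ∀ᶠ u in 𝓝[>] (0 : ℝ), u ∈ Ioo (0 : ℝ) 1 := Ioo_mem_nhdsGT one_pos
  have hs : ∀ᶠ s in 𝓝[>] (0 : ℝ), 0 < s := self_mem_nhdsWithin
  have ha : ∀ᶠ a in 𝓝 a₀, dist a a₀ < 1 / 2 := Metric.ball_mem_nhds a₀ (by norm_num)
  filter_upwards [(hu.prod_mk hs).prod_mk ha] with q hq
  obtain ⟨⟨hu', hs'⟩, ha'⟩ := hq
  refine twoScaleFibre_subset_dominator hu'.1 hs' ?_
  have h1 : |q.2| < 3 / 2 := by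
    have := abs_sub_abs_le_abs_sub q.2 a₀
    rw [Real.dist_eq] at ha'
    linarith
  have h2 : q.2 ^ 2 < (3 / 2) ^ 2 := by
    rw [← sq_abs]; exact pow_lt_pow_left₀ h1 (abs_nonneg _) two_ne_zero
  nlinarith [hu'.1, hu'.2]

end Summit.QuantumFields.YangMills.Theorems.SwapVirialDeficit.BlowUpRing

end
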